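import Literature.AlgebraicGeometry.Resolution.RegularLocalOrderValuation
import Literature.AlgebraicGeometry.Resolution.OrderGenerization
import Summits.ResolutionOfSingularities.ResolutionOfSingularities.Theorems.WeightedInvariantIotaOrderPolynomialFibre
import Summits.ResolutionOfSingularities.ResolutionOfSingularities.Theorems.WeightedInvariantHypersurfaceLocalGameEFT3
import Mathlib.SetTheory.Cardinal.ENat
import Mathlib.SetTheory.Ordinal.Basic
import Mathlib.RingTheory.LocalRing.RingHom.Basic
import Mathlib.RingTheory.Localization.AtPrime.Basic
import HarnessLib

/-!
# The first `ι`-instance of the H2a″ design: the `𝔪`-adic ORDER FUNCTION `iotaOrd`, with (c6) iso-invariance,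
# (c10) torus-factor monotonicity and (c7) generization monotonicity on REGULAR local rings — door
# `HypersurfaceCentreConstruction` (stmt-ResolutionOfSingularities-19897), route `WeightedInvariant`

[OURS · L1 W4.3 · cell `res-hironaka`, HUMAN RULING D-0089] Helper file `--supports stmt-ResolutionOfSingularities-19897`
written on res-L1-w43-plan-1's ORDER (o11) 2026-08-27T05:00:08Z («FIRST ι-INSTANCE, the ORDER FUNCTION»; context
`L/res-L1-w43-plan-1/CRUX-PLAN.md` §v6.8 addenda 1–5 and `eft_sketch_v4.lean`: the H2a″ clauses (c6) `IotaIsoInvariant`,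
(c7) `IotaGenerizationMonotone`, (c10) `IotaTorusFactorMonotone`, (c12a) `IotaUnitInvariant` on a class function
`ι : (R : Type) → [CommRing R] → R → Ordinal.{0}`). Typer res-type-073. AI-produced, weaker than expert review. NOT a
statement of the manuscript under review (Hironaka 2017); nothing here is attributed to its author; nothing here is a claim
about resolution of singularities. The clause PREDICATES (c6) `IotaIsoInvariant`, (c7) `IotaGenerizationMonotone`, (c10)
`IotaTorusFactorMonotone`, (c12a) `IotaUnitInvariant` are IMPORTED from the planner's landed clause module
`Theorems/WeightedInvariantHypersurfaceLocalGameEFT3.lean` (eft_sketch v8, p501595; OURS design candidates); this file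
declares only `ordOfENat` and `iotaOrd` and proves the four clauses for `ι := iotaOrd`.

## Contents (sorry-free, standard axioms)

* `ordOfENat : ℕ∞ → Ordinal.{0}` (`n ↦ n`, `⊤ ↦ ω`; strictly monotone) and **`iotaOrd R g`** := the `𝔪`-adic order
  `ord_𝔪(g) = sup {n | g ∈ 𝔪ⁿ}` of `g` in `R` when `R` is a local ring (the tree's `adicOrder`, `ℕ∞`-valued, sent to
  `Ordinal` by `ordOfENat`), junk `0` when `R` is not local. DESIGN NOTE: an element lying in every power of `𝔪` (in a
  Noetherian local ring: only `0`, Krull) gets the honest value `ω`, not a junk natural number; at the game's positions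
  (`0 ≠ f` in a regular local ring) `iotaOrd` is a natural number (`iotaOrd_lt_omega0_of_ne_zero`).
* (c6) `iotaOrd_isoInvariant : IotaIsoInvariant iotaOrd` — transport along `R ≃+* T`; (c12a)
  `iotaOrd_unitInvariant : IotaUnitInvariant iotaOrd` — `ord(v·g) = ord(g)` for units `v`.
* (c10) `iotaOrd_torusFactorMonotone : IotaTorusFactorMonotone iotaOrd` (the clause asks it for regular local `S`) from
  the GENERAL `iotaOrd_torusFactor_le`: for EVERY local ring `(S, 𝔪)`, every `f ∈ S` and every prime `𝔮 ⊂ S[X]` with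
  `𝔮 ∩ S = 𝔪`: `ord_{S[X]_𝔮}(f) ≤ ord_S(f)`. Kernel of the proof (sibling
  file `WeightedInvariantIotaOrderPolynomialFibre.lean`, `mem_maximalIdeal_pow_of_mul_C_mem_pow`): the image of `𝔮` in
  `k[X]` (`k = S/𝔪`) is `0` or is generated by a monic irreducible `Ḡ`; in the first case `𝔮 = 𝔪S[X]` and a unit coefficient of `s ∉ 𝔮` does it; in the second, lift `Ḡ` to a
  monic `F ∈ 𝔮`, so `𝔮 = 𝔪S[X] + (F)`, and push `s·f ∈ 𝔮ⁿ` into the finite free local `S`-algebra `A = S[X]/(F)`,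
  whose maximal ideal is `𝔪A`: there `s` becomes a unit, so `f ∈ 𝔪ⁿA ∩ S = 𝔪ⁿ` (faithful flatness). No Noetherian or
  regularity hypothesis on `S` is needed. (The reverse inequality is the trivial `𝔪ⁿS[X]_𝔮 ⊆ 𝔫ⁿ`; `iotaOrd_torusFactor_eq`.)
* (c7) `iotaOrd_generizationMonotone : IotaGenerizationMonotone iotaOrd` (regular local `S`, as the clause is typed since
  eft v8) from `iotaOrd_generization_le_of_isRegularLocalRing`: `ord_{S_𝔭}(f) ≤ ord_S(f)` for every prime `𝔭` of a
  regular local ring `S` and ANY localization `S_𝔭` — the local form of Zariski's `𝔭⁽ⁿ⁾ ⊆ 𝔪ⁿ`, ALREADY PROVED in the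
  tree (`Literature.AlgebraicGeometry.Resolution.mem_pow_of_algebraMap_mem_pow`, Cossart–Piltant 2008 Prop. 4.2
  (proof) / Nagata (38.3)); no named fact is needed. Off the regular local class the inequality fails for the order
  function (e.g. `S = k[x,y]_{(x,y)}/(xy)`, `𝔭 = (x)`, `f = x ↦ 0` in `S_𝔭 = k(y)`; or the quadric cone `xz = y²`,
  `𝔭 = (y,z)`, `f = z = y²/x ∈ 𝔭⁽²⁾ ∖ 𝔪²`), which is why the clause carries `[IsRegularLocalRing S]`.

## Sources

* O. Zariski, P. Samuel, *Commutative Algebra* II, Ch. VIII §1 (order function of a local ring). [ZariskiSamuel1960]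
* V. Cossart, O. Piltant, J. Algebra 320 (2008), proof of Prop. 4.2 (`ord_P ≤ ord_𝔪` in regular local rings). [CossartPiltant2008]
* res-L1-w43-plan-1, `CRUX-PLAN.md` §v6.8 + `eft_sketch_v4.lean` (clauses (c6)(c7)(c10); OURS, AI planning).
-/

noncomputable section

set_option linter.dupNamespace false -- mandated namespace `Summit.<Summit>.<Problem>` of this single-conjunct summit

open IsLocalRing Polynomial Literature.AlgebraicGeometry.Resolution

namespace Summit.ResolutionOfSingularities.ResolutionOfSingularities.Cruxes.HypersurfaceCentreConstruction.LocalEngine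

/-! ## The clause predicates

(c6) `IotaIsoInvariant`, (c7) `IotaGenerizationMonotone` (regular local `S`), (c10) `IotaTorusFactorMonotone` (regular
local `S`) and (c12a) `IotaUnitInvariant` are the tree's declarations of
`Theorems/WeightedInvariantHypersurfaceLocalGameEFT3.lean` (res-L1-w43-plan-1, eft_sketch v8, p501595) — imported, not
re-declared. -/

/-! ## `ℕ∞ → Ordinal` -/

/-- [OURS] The order-embedding `ℕ∞ → Ordinal`: `n ↦ n`, `⊤ ↦ ω` (through `Cardinal.ofENat` and `Cardinal.ord`). [folklore] -/
def ordOfENat (x : ℕ∞) : Ordinal.{0} := (Cardinal.ofENat.{0} x).ord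

/-- `ordOfENat n = n`. [folklore] -/
@[simp] theorem ordOfENat_natCast (n : ℕ) : ordOfENat n = n := by
  simp [ordOfENat]

/-- `ordOfENat ⊤ = ω`. [folklore] -/
@[simp] theorem ordOfENat_top : ordOfENat ⊤ = Ordinal.omega0 := by
  simp [ordOfENat]

/-- `ordOfENat` is strictly monotone. [folklore] -/
theorem ordOfENat_strictMono : StrictMono ordOfENat :=
  Cardinal.ord_strictMono.comp Cardinal.ofENat_strictMono

/-- `ordOfENat x ≤ ordOfENat y ↔ x ≤ y`. [folklore] -/
@[simp] theorem ordOfENat_le_ordOfENat {x y : ℕ∞} : ordOfENat x ≤ ordOfENat y ↔ x ≤ y :=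
  ordOfENat_strictMono.le_iff_le

/-- `ordOfENat x < ordOfENat y ↔ x < y`. [folklore] -/
@[simp] theorem ordOfENat_lt_ordOfENat {x y : ℕ∞} : ordOfENat x < ordOfENat y ↔ x < y :=
  ordOfENat_strictMono.lt_iff_lt

/-- `ordOfENat x = ordOfENat y ↔ x = y`. [folklore] -/
@[simp] theorem ordOfENat_inj {x y : ℕ∞} : ordOfENat x = ordOfENat y ↔ x = y :=
  ordOfENat_strictMono.injective.eq_iff

/-- `ordOfENat x ≤ ω`. [folklore] -/
theorem ordOfENat_le_omega0 (x : ℕ∞) : ordOfENat x ≤ Ordinal.omega0 := by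
  rw [← ordOfENat_top, ordOfENat_le_ordOfENat]
  exact le_top

/-- `ordOfENat x < ω ↔ x ≠ ⊤`. [folklore] -/
theorem ordOfENat_lt_omega0_iff {x : ℕ∞} : ordOfENat x < Ordinal.omega0 ↔ x ≠ ⊤ := by
  rw [← ordOfENat_top, ordOfENat_lt_ordOfENat, lt_top_iff_ne_top]

/-! ## The order function `iotaOrd` -/

open Classical in
/-- [OURS · first `ι`-instance, ORDER (o11) of res-L1-w43-plan-1] **The order function**: for a LOCAL ring `(R, 𝔪)` and
`g ∈ R`, `iotaOrd R g = ord_𝔪(g) = sup {n | g ∈ 𝔪ⁿ}` read in `Ordinal` (`ω` when `g ∈ 𝔪ⁿ` for all `n`); junk value `0`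
when `R` is not local. Binder shape `(R : Type) → [CommRing R] → R → Ordinal.{0}` of the H2a′/H2a″ sketches.
[cite: ZariskiSamuel1960, Ch. VIII §1] -/
def iotaOrd (R : Type) [CommRing R] (g : R) : Ordinal.{0} :=
  if h : IsLocalRing R then ordOfENat (@adicOrder R _ h g) else 0

/-- On a local ring `iotaOrd R g = ordOfENat (adicOrder g)`. [folklore] -/
theorem iotaOrd_eq_ordOfENat_adicOrder (R : Type) [CommRing R] [h : IsLocalRing R] (g : R) :
    iotaOrd R g = ordOfENat (adicOrder g) := by
  unfold iotaOrd
  rw [dif_pos h]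

/-- Off the local rings `iotaOrd R g = 0` (junk). [folklore] -/
theorem iotaOrd_of_not_isLocalRing (R : Type) [CommRing R] (h : ¬ IsLocalRing R) (g : R) : iotaOrd R g = 0 := by
  unfold iotaOrd
  rw [dif_neg h]

/-- `n ≤ iotaOrd R g ↔ g ∈ 𝔪ⁿ` on a local ring. [folklore] -/
theorem natCast_le_iotaOrd_iff (R : Type) [CommRing R] [IsLocalRing R] (g : R) (n : ℕ) :
    (n : Ordinal) ≤ iotaOrd R g ↔ g ∈ maximalIdeal R ^ n := by
  rw [iotaOrd_eq_ordOfENat_adicOrder, ← ordOfENat_natCast, ordOfENat_le_ordOfENat, le_adicOrder_iff]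

/-- `iotaOrd R g ≤ ω`. [folklore] -/
theorem iotaOrd_le_omega0 (R : Type) [CommRing R] (g : R) : iotaOrd R g ≤ Ordinal.omega0 := by
  by_cases h : IsLocalRing R
  · rw [iotaOrd_eq_ordOfENat_adicOrder]
    exact ordOfENat_le_omega0 _
  · rw [iotaOrd_of_not_isLocalRing R h]
    exact Ordinal.omega0_pos.le

/-- `iotaOrd R g = ω ↔ g ∈ 𝔪ⁿ` for every `n`, on a local ring. [folklore] -/
theorem iotaOrd_eq_omega0_iff (R : Type) [CommRing R] [IsLocalRing R] (g : R) :
    iotaOrd R g = Ordinal.omega0 ↔ ∀ n : ℕ, g ∈ maximalIdeal R ^ n := by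
  rw [iotaOrd_eq_ordOfENat_adicOrder, ← ordOfENat_top, ordOfENat_inj, ENat.eq_top_iff_forall_ge]
  exact forall_congr' fun n => le_adicOrder_iff g n

/-- In a Noetherian local ring `iotaOrd R g = ω ↔ g = 0` (Krull). [folklore] -/
theorem iotaOrd_eq_omega0_iff_eq_zero (R : Type) [CommRing R] [IsLocalRing R] [IsNoetherianRing R] (g : R) :
    iotaOrd R g = Ordinal.omega0 ↔ g = 0 := by
  rw [iotaOrd_eq_ordOfENat_adicOrder, ← ordOfENat_top, ordOfENat_inj, adicOrder_eq_top_iff]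

/-- At a game position (`g ≠ 0` in a Noetherian local ring, e.g. a regular one) `iotaOrd R g < ω`, i.e. the order is a
natural number. [folklore] -/
theorem iotaOrd_lt_omega0_of_ne_zero (R : Type) [CommRing R] [IsLocalRing R] [IsNoetherianRing R] {g : R}
    (hg : g ≠ 0) : iotaOrd R g < Ordinal.omega0 :=
  lt_of_le_of_ne (iotaOrd_le_omega0 R g) fun h => hg ((iotaOrd_eq_omega0_iff_eq_zero R g).mp h)

/-- `iotaOrd R g = n ↔ g ∈ 𝔪ⁿ ∖ 𝔪ⁿ⁺¹` on a local ring. [folklore] -/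
theorem iotaOrd_eq_natCast_iff (R : Type) [CommRing R] [IsLocalRing R] (g : R) (n : ℕ) :
    iotaOrd R g = n ↔ g ∈ maximalIdeal R ^ n ∧ g ∉ maximalIdeal R ^ (n + 1) := by
  rw [iotaOrd_eq_ordOfENat_adicOrder, ← ordOfENat_natCast, ordOfENat_inj, le_antisymm_iff, adicOrder_le_iff,
    le_adicOrder_iff, and_comm]

/-- **Comparison principle**: for local rings `R`, `T` and elements `g`, `g'`, if `g' ∈ 𝔪_Tⁿ ⟹ g ∈ 𝔪_Rⁿ` for every `n`
then `iotaOrd T g' ≤ iotaOrd R g`. [folklore] -/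
theorem iotaOrd_le_iotaOrd_of_forall (R T : Type) [CommRing R] [IsLocalRing R] [CommRing T] [IsLocalRing T]
    (g : R) (g' : T) (h : ∀ n : ℕ, g' ∈ maximalIdeal T ^ n → g ∈ maximalIdeal R ^ n) :
    iotaOrd T g' ≤ iotaOrd R g := by
  rw [iotaOrd_eq_ordOfENat_adicOrder, iotaOrd_eq_ordOfENat_adicOrder, ordOfENat_le_ordOfENat]
  refine ENat.forall_natCast_le_iff_le.mp fun n hn => ?_
  rw [le_adicOrder_iff] at hn ⊢
  exact h n hn

/-- The trivial direction: along ANY ring map `φ : R → T` of local rings with `φ(𝔪_R) ⊆ 𝔪_T` the order does not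
decrease, `iotaOrd R g ≤ iotaOrd T (φ g)` (`φ(𝔪_Rⁿ) ⊆ 𝔪_Tⁿ`). [folklore] -/
theorem iotaOrd_le_of_ringHom (R T : Type) [CommRing R] [IsLocalRing R] [CommRing T] [IsLocalRing T]
    (φ : R →+* T) (hφ : (maximalIdeal R).map φ ≤ maximalIdeal T) (g : R) :
    iotaOrd R g ≤ iotaOrd T (φ g) := by
  refine iotaOrd_le_iotaOrd_of_forall T R (φ g) g fun n hn => ?_
  have : φ g ∈ (maximalIdeal R ^ n).map φ := Ideal.mem_map_of_mem φ hn
  rw [Ideal.map_pow] at this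
  exact Ideal.pow_right_mono hφ n this

/-! ## (c6) Iso-invariance -/

/-- **(c6) for the order function**: `iotaOrd T (e g) = iotaOrd R g` for every ring isomorphism `e : R ≃+* T`
(`e` carries `𝔪_R` onto `𝔪_T`; a ring isomorphic to a non-local ring is non-local). [OURS · L1 W4.3, kernel] -/
theorem iotaOrd_isoInvariant : IotaIsoInvariant iotaOrd := by
  intro R T _ _ e g
  by_cases hR : IsLocalRing R
  · haveI : IsLocalRing T := e.isLocalRing
    refine le_antisymm ?_ ?_
    · refine iotaOrd_le_iotaOrd_of_forall R T g (e g) fun n hn => ?_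
      rw [← map_ringEquiv_maximalIdeal e, ← Ideal.map_pow, Ideal.apply_mem_of_equiv_iff] at hn
      exact hn
    · refine iotaOrd_le_iotaOrd_of_forall T R (e g) g fun n hn => ?_
      rw [← map_ringEquiv_maximalIdeal e, ← Ideal.map_pow, Ideal.apply_mem_of_equiv_iff]
      exact hn
  · have hT : ¬ IsLocalRing T := fun hT => hR e.symm.isLocalRing
    rw [iotaOrd_of_not_isLocalRing R hR, iotaOrd_of_not_isLocalRing T hT]

/-! ## (c12a) Unit invariance -/

/-- **(c12a) for the order function**: `iotaOrd R (v * g) = iotaOrd R g` for a unit `v` (`v·g ∈ 𝔪ⁿ ↔ g ∈ 𝔪ⁿ`; off the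
local rings both sides are the junk `0`) — the order depends on the ideal `(g)` only. [folklore] -/
theorem iotaOrd_unitInvariant : IotaUnitInvariant iotaOrd := by
  intro R _ v g hv
  by_cases hR : IsLocalRing R
  · refine le_antisymm ?_ ?_
    · exact iotaOrd_le_iotaOrd_of_forall R R g (v * g) fun n hn => (Ideal.unit_mul_mem_iff_mem _ hv).mp hn
    · exact iotaOrd_le_iotaOrd_of_forall R R (v * g) g fun n hn => (Ideal.unit_mul_mem_iff_mem _ hv).mpr hn
  · rw [iotaOrd_of_not_isLocalRing R hR, iotaOrd_of_not_isLocalRing R hR]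

/-! ## (c7) Generization on regular local rings (Zariski–Nagata, tree) -/

/-- **(c7) for the order function, on REGULAR local rings**: `ord_{S_𝔭}(f) ≤ ord_S(f)` for every prime `𝔭` of a regular
local ring `S` and every localization `S_𝔭` of `S` at `𝔭` — the local form of `𝔭⁽ⁿ⁾ ⊆ 𝔪ⁿ`, from the tree's
`mem_pow_of_algebraMap_mem_pow`. [cite: CossartPiltant2008, Prop. 4.2 (proof)] -/
theorem iotaOrd_generization_le_of_isRegularLocalRing (S : Type) [CommRing S] [IsRegularLocalRing S]
    (𝔭 : Ideal S) [𝔭.IsPrime] (Sp : Type) [CommRing Sp] [Algebra S Sp] [IsLocalization.AtPrime Sp 𝔭]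
    [IsLocalRing Sp] (f : S) :
    iotaOrd Sp (algebraMap S Sp f) ≤ iotaOrd S f :=
  iotaOrd_le_iotaOrd_of_forall S Sp f (algebraMap S Sp f) fun _ hn => mem_pow_of_algebraMap_mem_pow 𝔭 Sp hn

/-- **(c7) for the order function**: `IotaGenerizationMonotone iotaOrd` (the tree's clause, eft v8: regular local `S`).
[cite: CossartPiltant2008, Prop. 4.2 (proof)] -/
theorem iotaOrd_generizationMonotone : IotaGenerizationMonotone iotaOrd := by
  intro S _ _ 𝔭 _ f
  exact iotaOrd_generization_le_of_isRegularLocalRing S 𝔭 (Localization.AtPrime 𝔭) f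

/-! ## (c10) The torus factor: primes of `S[X]` over `𝔪`

The commutative algebra — for ANY local ring `(S, 𝔪)` and prime `𝔮 ⊂ S[X]` with `𝔮 ∩ S = 𝔪`,
`𝔮ⁿS[X]_𝔮 ∩ S = 𝔪ⁿ` — is the sibling helper file `WeightedInvariantIotaOrderPolynomialFibre.lean`
(`mem_maximalIdeal_pow_of_algebraMap_C_mem_pow`, `adicOrder_algebraMap_C`, same namespace). -/


/-- **(c10), general form**: for EVERY local ring `(S, 𝔪)` (no Noetherian / regularity hypothesis), `f ∈ S` and
prime `𝔮 ⊂ S[X]` over `𝔪`, `ord_{S[X]_𝔮}(f) ≤ ord_S(f)`. [OURS · L1 W4.3, kernel] -/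
theorem iotaOrd_torusFactor_le (S : Type) [CommRing S] [IsLocalRing S] (f : S) (𝔮 : Ideal (Polynomial S))
    [𝔮.IsPrime] (h𝔮 : 𝔮.comap (Polynomial.C : S →+* Polynomial S) = IsLocalRing.maximalIdeal S) :
    iotaOrd (Localization.AtPrime 𝔮) (algebraMap (Polynomial S) (Localization.AtPrime 𝔮) (Polynomial.C f)) ≤
      iotaOrd S f :=
  iotaOrd_le_iotaOrd_of_forall S (Localization.AtPrime 𝔮) f _ fun _ hn =>
    mem_maximalIdeal_pow_of_algebraMap_C_mem_pow 𝔮 h𝔮 (Localization.AtPrime 𝔮) hn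

/-- **(c10) for the order function**: `IotaTorusFactorMonotone iotaOrd` (the tree's clause, eft v8: regular local `S`;
a special case of `iotaOrd_torusFactor_le`). [OURS · L1 W4.3, kernel] -/
theorem iotaOrd_torusFactorMonotone : IotaTorusFactorMonotone iotaOrd := by
  intro S _ _ f 𝔮 _ h𝔮
  exact iotaOrd_torusFactor_le S f 𝔮 h𝔮

/-- And the order does not DROP either along `S → S[X]_𝔮`: the points of `{y} × 𝔾ₘ` keep EXACTLY the order of `y`,
`iotaOrd (S[X]_𝔮) f = iotaOrd S f` (`adicOrder_algebraMap_C`). [folklore] -/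
theorem iotaOrd_torusFactor_eq (S : Type) [CommRing S] [IsLocalRing S] (f : S) (𝔮 : Ideal (Polynomial S))
    [𝔮.IsPrime] (h𝔮 : 𝔮.comap (Polynomial.C : S →+* Polynomial S) = IsLocalRing.maximalIdeal S) :
    iotaOrd (Localization.AtPrime 𝔮) (algebraMap (Polynomial S) (Localization.AtPrime 𝔮) (Polynomial.C f)) =
      iotaOrd S f := by
  rw [iotaOrd_eq_ordOfENat_adicOrder, iotaOrd_eq_ordOfENat_adicOrder, ordOfENat_inj]
  exact adicOrder_algebraMap_C 𝔮 h𝔮 (Localization.AtPrime 𝔮) f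

end Summit.ResolutionOfSingularities.ResolutionOfSingularities.Cruxes.HypersurfaceCentreConstruction.LocalEngine

end
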